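import Mathlib
import HarnessLib
import HarnessLib.Audit
import Summits.SmoothPoincare4.Statement
import Literature.Topology.FourManifolds.IntersectionNumbers
import Literature.Topology.FourManifolds.SphereFamilySurgery
import Literature.Topology.FourManifolds.ConnectedSum

/-!
Route: CommonDualRelay

DORMANT since 2026-09-04T16:52:06Z (reconciler: no traction for 5.1 d (last activity statement-checked at 2026-08-30T14:49:41Z); parked, not closed — `ledger route dormant route-SmoothPoincare4-CommonDualRelay --off` to reactivate) — unstaffed, not closed; items shared with open routes are served there. `ledger route dormant <id> --off` reactivates.

# Route CommonDualRelay — Smale's handle cancellation in transit — common duals for the whole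
middle-level system on ONE S²×S² summand, then one-summand cancellation

LENS = TRANSFER (sibling: Smale's h-cobordism theorem, n ≥ 5; same failing step as Freedman's TOP
proof). It suffices to show X = R ∧ S2.
R (ONE-SUMMAND COMMON DUALS, "the relay", crux OneSummandCommonDuals): in a closed simply connected
smooth 4-manifold N that contains one FREE
dual pair (F, T) — two framed embedded spheres meeting once, disjoint from everything else, i.e. one
S²×S² summand off to the side — any two
framed k-systems of pairwise disjoint embedded 2-spheres A = (Aᵢ) and C = (Cᵢ) that are
componentwise homotopic, A carrying a geometric dual
system G (|Gᵢ ⋔ Aⱼ| = δᵢⱼ) and C a geometric dual system P, admit a COMMON geometric dual system σ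
(|σᵢ ⋔ Aⱼ| = δᵢⱼ = |σᵢ ⋔ Cⱼ|, σ framed,
pairwise disjoint). S2 = StabCancellation = route Stabilisation's S2 (stmt-SmoothPoincare4-0385: Σ #
(S²×S²) ≅ S²×S² ⇒ Σ ≅ S⁴), restated at rev 3
(cone repair) over the Statement's own bare binders (M, C^∞ atlas on 𝓡 4, e : M ≃ₕ S⁴ — no
HomotopySphere packaging, so no homotopy-sphere /
h-cobordism module is imported) and EQUIVALENT to stmt-0385 (planner Bridge.lean, both directions,
standard axioms).
Chain: the middle level of the h-cobordism S⁴ ~ Σ (DualPresentation) is such a configuration after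
one stabilisation; R gives σ; Gabai's
light bulb theorem FOR SYSTEMS (Gabai2020 Thm 10.1, item GabaiSystemsLightBulb) isotopes A onto C;
surgery along A resp. C gives Σ # S²×S²
resp. S²×S² (SurgeryImageInvariance), so Σ # S²×S² ≅ S²×S² (= Stabilisation's S1, now DERIVED); S2
finishes. No idea card realised (lens seat).
Lean: `open scoped ContDiff in ((∀ (N : Type) [TopologicalSpace N] [T2Space N]
[SecondCountableTopology N] [ChartedSpace (EuclideanSpace ℝ (Fin 4)) N] [IsManifold (𝓡 4) ∞ N]
[CompactSpace N] [SimplyConnectedSpace N] (oN : Literature.Topology.FourManifolds.SmoothOrientation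
(𝓡 4) N) (oS : Literature.Topology.FourManifolds.SmoothOrientation (𝓡 2) (Metric.sphere (0 :
EuclideanSpace ℝ (Fin 3)) 1)) (k : ℕ) (A G C P :
Literature.Topology.FourManifolds.FramedSphereFamily (𝓡 4) N (Fin k) 2 2) (F T :
Literature.Topology.FourManifolds.FramedSphereFamily (𝓡 4) N (Fin 1) 2 2),
Literature.Topology.FourManifolds.IsGeometricallyDual (𝓡 2) (𝓡 2) (𝓡 4) two_add_two_eq_four oS oS oN
G.sphere A.sphere → Literature.Topology.FourManifolds.IsGeometricallyDual (𝓡 2) (𝓡 2) (𝓡 4)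
two_add_two_eq_four oS oS oN C.sphere P.sphere → (∀ i, (⟨A.sphere i, A.continuous_sphere i⟩ :
C(↥(Metric.sphere (0 : EuclideanSpace ℝ (Fin 3)) 1), N)).Homotopic ⟨C.sphere i, C.continuous_sphere
i⟩) → Literature.Topology.FourManifolds.IsGeometricallyDual (𝓡 2) (𝓡 2) (𝓡 4) two_add_two_eq_four oS
oS oN F.sphere T.sphere → Disjoint (F.cores ∪ T.cores) (A.cores ∪ G.cores ∪ C.cores ∪ P.cores) → ∃ σ
: Literature.Topology.FourManifolds.FramedSphereFamily (𝓡 4) N (Fin k) 2 2,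
Literature.Topology.FourManifolds.IsGeometricallyDual (𝓡 2) (𝓡 2) (𝓡 4) two_add_two_eq_four oS oS oN
σ.sphere A.sphere ∧ Literature.Topology.FourManifolds.IsGeometricallyDual (𝓡 2) (𝓡 2) (𝓡 4)
two_add_two_eq_four oS oS oN σ.sphere C.sphere) ∧ (∀ (M : Type) [TopologicalSpace M] [T2Space M]
[SecondCountableTopology M] [ChartedSpace (EuclideanSpace ℝ (Fin 4)) M] [IsManifold (𝓡 4) ∞ M],
ContinuousMap.HomotopyEquiv M (Metric.sphere (0 : EuclideanSpace ℝ (Fin 5)) 1) → (∃ (P : Type) (_ :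
TopologicalSpace P) (_ : ChartedSpace (EuclideanSpace ℝ (Fin 4)) P) (_ : IsManifold (𝓡 4) ∞ P),
Literature.Topology.FourManifolds.IsConnectedSum (𝓡 4) (𝓡 4) ((𝓡 2).prod (𝓡 2)) M ((Metric.sphere (0
: EuclideanSpace ℝ (Fin 3)) 1) × (Metric.sphere (0 : EuclideanSpace ℝ (Fin 3)) 1)) P ∧ Nonempty (P
≃ₘ⟮𝓡 4, (𝓡 2).prod (𝓡 2)⟯ ((Metric.sphere (0 : EuclideanSpace ℝ (Fin 3)) 1) × (Metric.sphere (0 :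
EuclideanSpace ℝ (Fin 3)) 1)))) → Nonempty (M ≃ₘ⟮𝓡 4, 𝓡 4⟯ Metric.sphere (0 : EuclideanSpace ℝ (Fin
5)) 1)))`

## Assembly
Pure logic over the items (certified rev 3: folder Sketch.lean / glue.lean, `closes` 8 tactic lines,
lean check rc 0, 0 sorries, audit
`closes` ok, axioms propext · Classical.choice · Quot.sound): given the Statement's M, atlas and e :
M ≃ₕ S⁴ — exactly the binders over which
StabCancellation and DualPresentation are stated since rev 3, so NOTHING is packaged (no
HomotopySphere, no compactness / orientability
lemma, no homotopy-sphere or h-cobordism module in the import cone) — StabCancellation M e reduces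
the goal to the one-stabilisation witness
∃ P, IsConnectedSum M (S²×S²) P ∧ P ≃ₘ S²×S²; DualPresentation M e gives (N, A, G, C, P, F, T) with
surgery data (P₁ a connected sum
M # S²×S² obtained by surgery along A; Y ≅ S²×S² obtained by surgery along C); OneSummandCommonDuals
gives σ; GabaiSystemsLightBulb gives φ
with φ(Aᵢ) = Cᵢ; SurgeryImageInvariance gives P₁ ≅ Y ≅ S²×S², the witness. `closes :
DualPresentation → OneSummandCommonDuals →
GabaiSystemsLightBulb → SurgeryImageInvariance → StabCancellation → SmoothPoincare4` uses every
hypothesis; Target (rank 0), the two rung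
supports and the item Assembly are not hypotheses.

Rationale: WHY THIS LINE. Transfer of Smale's proof (n ≥ 5) step by step: (1) Σ is h-cobordant to S⁴ —
transfers (Θ₄ = 0 as h-cobordism group, KervaireMilnorAnnals1963,
WallJLMS1964 Thm 2); (2) 2- /3-handle normal form — transfers (MilnorHCobordism1965; tree theorem
exists_isMorseFunction_two_three_of_isHCobordism_holds);
(3) identity intersection matrix by slides — transfers (Milnor Thm 7.6); (4) WHITNEY TRICK making
the descending spheres A geometrically dual to
the belt spheres P — FAILS (2+2 = 4; Freedman's Casson-handle repair is TOP only,
DonaldsonIrrationality1987 kills the general smooth principle);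
(5) cancellation — transfers. The smooth four-dimensional REPLACEMENT of step 4 that exists in print
is Gabai's light bulb theorem, whose
systems form (Gabai2020 Thm 10.1: two k-systems Rᵢ ≃ Sᵢ with a COMMON dual system are simultaneously
isotopic) needs common duals, and
AucklyEtAl2019 (Theorem, p. 3: immersed common dual by finger/Whitney moves, embedded by tubing into
the S-sphere of ONE new S²×S² summand and
the Norman trick along its T-sphere) supplies a common dual for ONE pair at the price of ONE
summand; one summand per sphere merely re-proves
Wall's stabilisation theorem. The step that breaks IN TRANSIT is therefore the SUMMAND BUDGET — k
immersed common duals, one free summand —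
and that is crux R, whose k = 1 case is AKMRS's theorem (support CommonDualOnePair) and whose k = 2
case (support TwoPairRelay) is the first
open rung; R would answer Wall's 1964 question "is one stabilisation enough for h-cobordant simply
connected closed 4-manifolds" (still open:
doi:10.1112/jlms.70384 p. 3; Kang2022OneStabilization Question 1). Imported area: the
homotopy-versus-isotopy technology for spheres with
duals (Gabai2020, SchneidermanTeichner2022) and one-stabilisation isotopy (AucklyEtAl2019) — used on
THIS summit so far only for k = 1
cancellation (Stabilisation S2, ThreeFibres, ThreePointSpheres Cancel₃), never for the descent/S1
side, which every existing route leaves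
mechanism-free ("bets k = 1"; "no complexity-reducing move is known"). Negatives index: empty at
filing.

RANKED CRUXES. #0 Target (target) — X = R ∧ S2 (rev 3: both conjuncts over bare binders, no
HomotopySphere): the one-summand common-dual relay for dual-equipped sphere systems, and one-summand
cancellation for homotopy 4-spheres. (why it might fail: R may fail at k = 2 already (a
configuration needing two summands ⇒ a closed pair strictly 2-stably diffeomorphic, Kang's Question
1); S2 is SPC4 on 1-stably standard Σ.) [AucklyEtAl2019, Gabai2020, Kang2022OneStabilization,
WallJLMS1964]
#2 OneSummandCommonDuals (crux) — R, the relay: N closed simply connected smooth 4-manifold, oN/oS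
orientations, A G C P framed k-systems of disjoint embedded 2-spheres with G geometrically dual to A
and C geometrically dual to P (Matveyev's card δᵢⱼ), Aᵢ homotopic to Cᵢ for every i, and one free
framed dual pair (F, T) disjoint from A ∪ G ∪ C ∪ P ⇒ there is a framed k-system σ geometrically
dual to BOTH A and C. k = 1 is AKMRS's theorem; with Gabai Thm 10.1 R gives "one stabilisation is
enough" for every h-cobordant pair of simply connected closed 4-manifolds, in particular
Stabilisation's S1 for every homotopy 4-sphere. [difficulty: open-problem] (why it might fail:
AKMRS's embedding step spends the free pair (tube into F, Norman trick along T) on ONE immersed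
dual; for k ≥ 2 the others must be cleaned with duals Aₘ/Cₘ that meet the other system at
finger-move points — no relay known; a closed pair needing 2 summands (Kang Q1) kills it.)
[AucklyEtAl2019, Gabai2020, Kang2022OneStabilization, HaydenKangMukherjee2023, LinMukherjee2025,
doi:10.1112/jlms.70384, WallJLMS1964]
#3 StabCancellation (crux) — S2 of route Stabilisation (stmt-SmoothPoincare4-0385), restated at rev
3 (cone repair) over the Statement's bare binders (M Hausdorff, second countable, C^∞ atlas on 𝓡 4,
e : M ≃ₕ S⁴; M is then compact and orientable by the PROVED tree theorems
compactSpace_of_homotopyEquiv_sphere_four_holds / isOrientable_of_homotopyEquiv_sphere_four_holds,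
which provers may invoke — neither is a hypothesis) and EQUIVALENT to stmt-0385 (planner
Bridge.lean: bare ↔ packaged, standard axioms; a proof of either closes the other in four lines):
every such M with some connected sum M # (S²×S²) diffeomorphic to S²×S² is diffeomorphic to S⁴ — the
LAST summand, which no transfer touches (in dimension ≥ 5 it is automatic by the h-cobordism
theorem). [difficulty: open-problem] (why it might fail: = SPC4 on 1-stably standard Σ: a jointly
knotted dual pair (A, G) ⊂ S²×S² with fake-ball complement refutes it; Gabai's LBT needs G standard;
no 4-d one-summand cancellation theorem exists (false at b₂ > 0, arXiv:1009.0514 Cor. 16).)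
[Gabai2020, WallJLMS1964, FreedmanGompfMorrisonWalker2010, arXiv:1009.0514, Matveyev1996,
CurtisFreedmanHsiangStong1996]
#4 DualPresentation (crux) — FACT-GATE (the steps of Smale's proof that DO transfer, plus the
classical normalisations the relay needs): for every smooth homotopy 4-sphere M (the Statement's
binders, e : M ≃ₕ S⁴) there are a closed simply connected smooth N, k, framed k-systems A, G, C, P
and a free framed dual pair F, T in N with G geometrically dual to A, C geometrically dual to P, Aᵢ
≃ Cᵢ, (F, T) disjoint from the rest, such that surgery along A gives a connected sum M # (S²×S²) and
surgery along C gives a copy of S²×S². On paper: h-cobordism S⁴ ~ M (Θ₄ = 0), two-three handlebody,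
middle level N₀ ≅ #k(S²×S²) with descending spheres A and belt spheres P (Milnor/Matveyev/Kirby),
cores-with-discs C dual to P and the symmetric Σ-side duals G of A (discs for trivial links in
simply connected 4-manifolds), Wall's realisation of the transvection aᵢ ↦ [Aᵢ] by a diffeomorphism
of #k(S²×S²) to make Aᵢ ≃ Cᵢ, then N = N₀ # (S²×S²) with F, T the new factors. [difficulty: XL] (why
it might fail: true on paper; the risk is formal — it rests on the UNPROVED tree facts
isHCobordant_sphere_of_homotopySphere_four and exists_dualSpheres_middleLevel_of_two_three plus an
untyped Wall-1964 realisation theorem for Diff(#k S²×S²), whose Lean forms must match this ∃-form.)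
[KervaireMilnorAnnals1963, WallJLMS1964, WallDiffeomorphisms1964, MilnorHCobordism1965,
Matveyev1996, KirbyCorks1996]
#9 GabaiSystemsLightBulb (crux · rank 9 since rev 1: fact-gate used by `closes`) — NAMED FACT,
Gabai's light bulb theorem for multiple spheres (Gabai2020 Thm 10.1, π₁ = 1 case, weakened to its
end diffeomorphism): in a closed simply connected smooth 4-manifold, two framed k-systems A, C of
pairwise disjoint embedded spheres with a common geometric dual system σ and Aᵢ ≃ Cᵢ for all i are
carried one onto the other by a self-diffeomorphism (the end of an ambient isotopy fixing σ):
φ(Aᵢ(S²)) = Cᵢ(S²). [difficulty: XL] [Gabai2020, SchneidermanTeichner2022]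
#9 SurgeryImageInvariance (crux · rank 9 since rev 1: fact-gate used by `closes`) — bookkeeping
(Milnor 1965 §3; Kosinski VI): if a self-diffeomorphism φ of a closed smooth 4-manifold N carries
the core spheres of a framed family A onto those of a framed family C (as images), then any surgery
result along A is diffeomorphic to any surgery result along C (uniqueness of tubular neighbourhoods;
π₂(SO(2)) = 0 and reflections/reparametrisations extend over D³×S¹; uniqueness of open gluings).
[difficulty: XL] [MilnorHCobordism1965, GompfStipsicz1999, WallDiffeomorphisms1964]
#9 CommonDualOnePair (support) — the k = 1 rung of R = the theorem of
Auckly–Kim–Melvin–Ruberman–Schwartz (AucklyEtAl2019, Theorem p. 3, ordinary case; the class of A is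
ordinary because its dual G is framed; complements are simply connected by Gabai2020 Lemma 2.2): one
pair (A, C) with duals and one free summand ⇒ an embedded framed common dual. Calibration of the
vocabulary; provable from the printed 2-page argument once finger/Whitney/Norman moves are
formalised. [difficulty: L] [AucklyEtAl2019, Gabai2020]
#9 TwoPairRelay (support) — the k = 2 rung of R (first open case; the smallest configuration where
the summand budget bites): two disjoint dual-equipped pairs, componentwise homotopic targets, one
free summand ⇒ a common dual system of two disjoint framed spheres. With Gabai Thm 10.1 it already
yields "two stabilisations ⇒ one" for homotopy 4-spheres presented with k = 2. [difficulty: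
open-problem] [AucklyEtAl2019, Gabai2020, Kang2022OneStabilization]

TWO-LAYER PLAN. Foreseen glued splits (nothing filed now): OneSummandCommonDuals ⇐
ImmersedCommonDuals (AKMRS step 1 for systems: immersed σ with the right
geometric counts, no stabilisation — finger moves of A across C allowed) → RelayEmbedding (embed k
immersed common duals pairwise disjointly
using one free pair plus the partial duals Aₘ, Cₘ) → OneSummandCommonDuals; and, if the general N is
too bold, the RESTRICTED relay
(hypothesis: surgery along C gives S⁴ # S²×S², i.e. the S⁴-configurations only) as a sibling child.
DualPresentation ⇐ SpherePresentation
(route ThreePointSpheres' item, to be shared) → DualUpgrade (G, C, Wall normalisation, stabilise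
once) → DualPresentation.

KILL CRITERIA. ¬OneSummandCommonDuals proved by an explicit closed configuration (equivalently a
closed simply connected h-cobordant pair needing two
S²×S² summands, Kang's Question 1 answered YES): if the witness is NOT an S⁴-configuration, restate
R to the S⁴-restricted relay (one `route
edit --restate`, foreseen above) — the line survives; if it IS an S⁴-configuration it exhibits a
homotopy 4-sphere needing k ≥ 2, refuting
Stabilisation's S1 too, and this route closes `refuted:OneSummandCommonDuals` (SPC4 itself survives
only via k ≥ 2 cancellation, a new
route). ¬StabCancellation ⇒ an exotic S⁴: close with the summit. S1 (StabOneSuffices, stmt-0386)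
proved elsewhere by another mechanism moots
R for SPC4 (route shrinks to S2, which is equivalent to Stabilisation's: close `superseded --by
route-SmoothPoincare4-Stabilisation`).

NOT DECOMPOSED YET. The immersed stage of the relay (finger/Whitney bookkeeping à la AKMRS p. 3–4)
and the embedding stage are layer-2 children (above); the
S⁴-restricted relay; the typed Wall-1964 realisation fact (Diff(#k S²×S²) → Aut(H₂) onto) and the
two middle-level facts feeding
DualPresentation (fact seats exist: provefact-…corkDecomposition, ThetaFourKervaireMilnor); any use
of Schneiderman–Teichner's FQ-invariant
form of the LBT (π₁ = 1 here, not needed); the cork-level reading of R (deliberately NOT claimed: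
Kang's barrier).

CHEAPEST FALSIFIER. Literature lookup, run 2026-08-16: is a CLOSED simply connected exotic
(h-cobordant) pair known that stays exotic after one S²×S²? No —
HaydenKangMukherjee2023 p. 1 ("To date, all examples … that remain exotic after one stabilization
have had nonempty boundary"), Powell's
survey doi:10.1112/jlms.70384 p. 3 ("famous open question"), Kang2022OneStabilization Question 1;
the 1-stably exotic surface LINKS of
LinMukherjee2025 Thm 1 are slice discs rel ∂ in punctured K3, outside R's closed hypothesis; AKMRS's
hypothesis (ii) (ordinary class) is
automatic here (framed duals) and (i) (connected) is replaced by the systems form with COMMON dual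
SYSTEM, which is exactly what is open.
Next cheapest: a family-Bauer–Furuta / Pin(2) computation on a k = 2 configuration in #3(S²×S²)
(LinMukherjee2025 methods vanish on spin
manifolds of this size — their Thm on S²×S² Torelli diffeos), so no known invariant can refute
TwoPairRelay either.

NUMBERS. k = 1: theorem (AucklyEtAl2019). k = 2: open (TwoPairRelay). Summands known to suffice for
h-cobordant simply connected closed pairs: SOME k
(WallJLMS1964 Thm 3); all explicit families checked need 1 (Auckly 2003, Akbulut 2002,
Baykur–Sunukjian; survey doi:10.1112/jlms.70384 p. 3);
with boundary 2 can be needed (Kang2022OneStabilization Thm 1.1 / Cor 1.2). Items: 9 (3 ranked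
cruxes + 2 rank-9 fact-gate cruxes, 2 supports, target, assembly). Cone (rev 3, route-repair
2026-08-16): route imports 7 → 3
(IntersectionNumbers, SphereFamilySurgery, ConnectedSum; dropped HomotopySpheres, SmoothOrientation
(still transitive), HomotopyS4CompactProofs,
HomotopyS4OrientableProofs); Literature modules in the import closure 27 → 7 (SPC4Wave0 via the
Statement, IntersectionNumbers, SmoothOrientation,
SphereFamilySurgery, CircleSurgery, ConnectedSum, MappingTorus); unproved named facts in it 15 → 13,
all 13 in SPC4Wave0 via the operator-owned
Statement import (summit-wide floor, same as ThreeFibres / ThreePointSpheres after their repairs;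
needs-fact: NONE — no item or `closes` mentions any of
the 15); gate used-constants cone 0 unproved before and after.

DEFINITION REQUESTS. None: FramedSphereFamily, IsGeometricallyDual, FramedSphereFamily.IsSurgery,
cores, IsConnectedSum, SmoothOrientation and
Mathlib's ContinuousMap.HomotopyEquiv / Homotopic / Diffeomorph suffice (all items elaborate,
Sketch.lean rc 0; HomotopySphere deliberately not used since rev 3). Wanted later as cite facts (not
filed now):
Gabai2020 Thm 10.1 and AucklyEtAl2019 Theorem as Literature named facts in
Literature/Topology/FourManifolds (they are route items meanwhile).

Novelty: Searches (2026-08-16): `lit search --source arxiv/zbmath/crossref "Isotopy of surfaces in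
4-manifolds after a single stabilization"` (found
AucklyEtAl2019, HaydenKangMukherjee2023, BaykurSunukjian2015, Lin 2023 K3#K3); `lit read
arxiv:1708.03208` (Theorem p. 3 verbatim), `lit read
arxiv:1705.09989 --grep` (Thm 1.2 p. 3, Thm 10.1 p. 22 verbatim), `lit read arxiv:2304.01504` pp.
1–2, `lit read arxiv:2110.09686` pp. 1–3,
`lit read doi:10.1112/jlms.70384 --grep "one stabili"` (p. 3); `lit frontier SmoothPoincare4 --since
2021` (30 rows; Wall-survey 2026 and
arXiv:2603.23717 noted); `lit galaxy search "single stabilization" --star all` (20 rows, none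
relevant), `"light bulb theorem" --star pdf` (0),
`"become diffeomorphic after one stabilization" --star pdf` (0); zbMATH/arXiv keyword searches
"stabilization h-cobordism 4-manifold",
"light bulb theorem stabilization h-cobordism" (0). Tree: grep of all 54 Theses and 160 cards for
Auckly/AKMRS/"common dual" — AKMRS only as
prior art in two audits (branch-surface-unknotting, odd-light-bulb-cp2), common duals only at k = 1
(ThreePointSpheres Cancel₃, EllipticRuledHost).
Nearest prior art found: AucklyEtAl2019 (doi:10.1016/j.aim.2018.10.040: one pair, one summand) and
Gabai2020 Thm 10.1 (arXiv:1705.09989: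
systems LBT given common duals); on this summit route Stabilisation (S1 with no mechanism) and
ThreePointSpheres ("OnePairDescent … not
decomposed").
Delta: points the AKMRS common-dual construction and Gabai's SYSTEMS light bulb theor  [refs: 10.1112/jlms.70384, 10.1016/j.aim.2018.10.040:, 1708.03208, 1705.09989, 2304.01504, 2110.09686, 2603.23717, arxiv:1708.03208, arxiv:1705.09989, arxiv:2304.01504, arxiv:2110.09686, doi:10.1112/jlms.70384, doi:10.1016/j.aim.2018.10.040, AucklyEtAl2019, HaydenKangMukherjee2023, BaykurSunukjian2015, Gabai2020]

Barriers (technique_class: stabilisation, light-bulb-isotopy, h-cobordism-middle-level): - technique_class: stabilisation, light-bulb-isotopy, h-cobordism-middle-level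
- Literature.Barriers.SmoothPoincare4.OneStabilisationBarrier: Kang's corks and Akbulut–Ruberman
pairs have BOUNDARY; R quantifies over CLOSED simply connected N (CompactSpace, boundaryless charts)
and claims nothing cork-level — it does not evade by mechanism, the bet is exactly Kang's open
Question 1 (closed ≠ bounded), with HaydenKangMukherjee2023 p. 1 recording that every known failure
has boundary.
- Literature.Barriers.SmoothPoincare4.HCobordismBarrierFour: the line never uses "h-cobordant ⇒
diffeomorphic"; step 4 of Smale is replaced by isotopy AFTER one summand (R + Gabai 10.1),
consistent with Donaldson's pairs (which are 1-stably diffeomorphic); the b₂ = 0 residue is carried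
openly as the shared crux StabCancellation.
- Literature.Barriers.SmoothPoincare4.StableBarrierFour: no stable (or any) invariant is used; the
route constructs isotopies, it does not separate manifolds.
- Literature.Barriers.SmoothPoincare4.HCobordismInvariantBarrierFour: same — no h-cobordism
invariant enters.
- Literature.Barriers.SmoothPoincare4.TopologicalBarrierFour: every step is smooth
(finger/Whitney/Norman moves, tubing, Gabai's smooth isotopy); nothing is read off the topological
type.
- Negatives index: empty at filing (`ledger negatives --problem SmoothPoincare4`: 0 refuted
statements).

History (route lifecycle, newest last):
- 2026-08-16T16:27:01Z · rev 3: restated Target (stmt-SmoothPoincare4-15788), StabCancellation (stmt-SmoothPoincare4-15790) — route-repair (cone, gen 1; unit rrepair-SmoothPoincare4-CommonDualRela-0210b6e0): RE-ROUTED AROUND the 2 route-side unproved facts (Cobordism.nonempty_homeomorp (planner-rrepair-SmoothPoincare4-CommonDualRela-0210b6e0-0)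
- 2026-08-24T03:24:00Z · DORMANT — reconciler: no traction for 6.5 d (last activity item-evidence-added at 2026-08-17T14:59:24Z); parked, not closed — `ledger route dormant route-SmoothPoincare4- (operator:999:1204251)
- 2026-08-30T14:34:31Z · REACTIVATED — reconciler: reactivated — activity statement-checked at 2026-08-30T13:47:04Z after parking at 2026-08-24T03:24:00Z (operator:999:3829466)
- 2026-09-04T16:52:06Z · DORMANT — reconciler: no traction for 5.1 d (last activity statement-checked at 2026-08-30T14:49:41Z); parked, not closed — `ledger route dormant route-SmoothPoincare4-Co (operator:999:1055828)

sub-problem: SmoothPoincare4 · status: dormant · opened planner-plan-lens-SmoothPoincare4-transfer-v2-0 2026-08-16T15:58:41Z · rev 4 · ledger route-SmoothPoincare4-CommonDualRelay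
GENERATED by the gate from the ledger (D-0016/17). Provers cite these decls: `theorem foo : Summit.SmoothPoincare4.SmoothPoincare4.Theses.CommonDualRelay.<Decl> := …` in Summits/SmoothPoincare4/SmoothPoincare4/Theorems/<Name>.lean.
-/

namespace Summit.SmoothPoincare4.SmoothPoincare4.Theses.CommonDualRelay

open scoped BigOperators Topology Manifold Classical MeasureTheory ProbabilityTheory Matrix InnerProductSpace ComplexConjugate ContinuousMap
open Filter Set Function TopologicalSpace MeasureTheory

attribute [summit_statement] _root_.SmoothPoincare4

open Literature.SPC4

-- earlier Target (stmt-SmoothPoincare4-15788, replaced 2026-08-16T16:27:01Z -> stmt-SmoothPoincare4-16192): retired by None — open scoped ContDiff in ((∀ (N : Type) [TopologicalSpace N] [T2Space N] [SecondCountableTopology N] [ChartedSpace (EuclideanSpace ℝ (Fin 4)) N] [IsManifold (𝓡 4) ∞ N] [CompactSpace N] [SimplyConnectedSpace N] (oN : Literature.Topology.FourManifolds.SmoothOrientation (𝓡 4) N) 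
/-- item stmt-SmoothPoincare4-16192 · target · rank 0 · open · by planner
why it might fail: R may fail at k = 2 already (a configuration needing two summands ⇒ a closed pair strictly 2-stably diffeomorphic, Kang's Question 1); S2 is SPC4 on 1-stably standard Σ.
sources: AucklyEtAl2019, Gabai2020, Kang2022OneStabilization, WallJLMS1964
[target] X = R ∧ S2 — rev 3 (cone repair): both conjuncts over bare binders (the S2 conjunct over
the Statement's own M, C^∞ atlas on 𝓡 4, e : M ≃ₕ S⁴ instead of `S : HomotopySphere 4`, so the route
imports no homotopy-sphere / h-cobordism module): the one-summand common-dual relay for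
dual-equipped sphere systems (R = OneSummandCommonDuals verbatim), and one-summand cancellation for
smooth homotopy 4-spheres (S2 = StabCancellation verbatim). -/
@[route_item "route-SmoothPoincare4-CommonDualRelay"]
def Target : Prop :=
  open scoped ContDiff in ((∀ (N : Type) [TopologicalSpace N] [T2Space N] [SecondCountableTopology N] [ChartedSpace (EuclideanSpace ℝ (Fin 4)) N] [IsManifold (𝓡 4) ∞ N] [CompactSpace N] [SimplyConnectedSpace N] (oN : Literature.Topology.FourManifolds.SmoothOrientation (𝓡 4) N) (oS : Literature.Topology.FourManifolds.SmoothOrientation (𝓡 2) (Metric.sphere (0 : EuclideanSpace ℝ (Fin 3)) 1)) (k : ℕ) (A G C P : Literature.Topology.FourManifolds.FramedSphereFamily (𝓡 4) N (Fin k) 2 2) (F T : Literature.Topology.FourManifolds.FramedSphereFamily (𝓡 4) N (Fin 1) 2 2), Literature.Topology.FourManifolds.IsGeometricallyDual (𝓡 2) (𝓡 2) (𝓡 4) two_add_two_eq_four oS oS oN G.sphere A.sphere → Literature.Topology.FourManifolds.IsGeometricallyDual (𝓡 2) (𝓡 2) (𝓡 4) two_add_two_eq_four oS oS oN C.sphere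 P.sphere → (∀ i, (⟨A.sphere i, A.continuous_sphere i⟩ : C(↥(Metric.sphere (0 : EuclideanSpace ℝ (Fin 3)) 1), N)).Homotopic ⟨C.sphere i, C.continuous_sphere i⟩) → Literature.Topology.FourManifolds.IsGeometricallyDual (𝓡 2) (𝓡 2) (𝓡 4) two_add_two_eq_four oS oS oN F.sphere T.sphere → Disjoint (F.cores ∪ T.cores) (A.cores ∪ G.cores ∪ C.cores ∪ P.cores) → ∃ σ : Literature.Topology.FourManifolds.FramedSphereFamily (𝓡 4) N (Fin k) 2 2, Literature.Topology.FourManifolds.IsGeometricallyDual (𝓡 2) (𝓡 2) (𝓡 4) two_add_two_eq_four oS oS oN σ.sphere A.sphere ∧ Literature.Topology.FourManifolds.IsGeometricallyDual (𝓡 2) (𝓡 2) (𝓡 4) two_add_two_eq_four oS oS oN σ.sphere C.sphere) ∧ (∀ (M : Type) [TopologicalSpace M] [T2Space M] [SecondCountableTopology M] [ChartedSpace (EuclideanSpace ℝ (Fin 4)) M] [IsManifold (𝓡 4) ∞ M], ContinuousMap.HomotopyEquiv M (Metric.sphere (0 : EuclideanSpace ℝ (Fin 5)) 1) → (∃ (P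 : Type) (_ : TopologicalSpace P) (_ : ChartedSpace (EuclideanSpace ℝ (Fin 4)) P) (_ : IsManifold (𝓡 4) ∞ P), Literature.Topology.FourManifolds.IsConnectedSum (𝓡 4) (𝓡 4) ((𝓡 2).prod (𝓡 2)) M ((Metric.sphere (0 : EuclideanSpace ℝ (Fin 3)) 1) × (Metric.sphere (0 : EuclideanSpace ℝ (Fin 3)) 1)) P ∧ Nonempty (P ≃ₘ⟮𝓡 4, (𝓡 2).prod (𝓡 2)⟯ ((Metric.sphere (0 : EuclideanSpace ℝ (Fin 3)) 1) × (Metric.sphere (0 : EuclideanSpace ℝ (Fin 3)) 1)))) → Nonempty (M ≃ₘ⟮𝓡 4, 𝓡 4⟯ Metric.sphere (0 : EuclideanSpace ℝ (Fin 5)) 1)))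

/-- item stmt-SmoothPoincare4-15789 · crux · rank 2 · open · by planner
why it might fail: AKMRS's embedding step spends the free pair (tube into F, Norman trick along T) on ONE immersed dual; for k ≥ 2 the others must be cleaned with duals Aₘ/Cₘ that meet the other system at finger-move points — no relay known; a closed pair needing 2 summands (Kang Q1) kills it.
sources: AucklyEtAl2019, Gabai2020, Kang2022OneStabilization, HaydenKangMukherjee2023, LinMukherjee2025, doi:10.1112/jlms.70384
[crux] R, the relay: N closed simply connected smooth 4-manifold, oN/oS orientations, A G C P framed
k-systems of disjoint embedded 2-spheres with G geometrically dual to A and C geometrically dual to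
P (Matveyev's card δᵢⱼ), Aᵢ homotopic to Cᵢ for every i, and one free framed dual pair (F, T)
disjoint from A ∪ G ∪ C ∪ P ⇒ there is a framed k-system σ geometrically dual to BOTH A and C. k = 1
is AKMRS's theorem; with Gabai Thm 10.1 R gives "one stabilisation is enough" for every h-cobordant
pair of simply connected closed 4-manifolds, in particular Stabilisation's S1 for every homotopy
4-sphere. [difficulty: open-problem] -/
@[route_item "route-SmoothPoincare4-CommonDualRelay"]
def OneSummandCommonDuals : Prop :=
  open scoped ContDiff in ∀ (N : Type) [TopologicalSpace N] [T2Space N] [SecondCountableTopology N] [ChartedSpace (EuclideanSpace ℝ (Fin 4)) N] [IsManifold (𝓡 4) ∞ N] [CompactSpace N] [SimplyConnectedSpace N] (oN : Literature.Topology.FourManifolds.SmoothOrientation (𝓡 4) N) (oS : Literature.Topology.FourManifolds.SmoothOrientation (𝓡 2) (Metric.sphere (0 : EuclideanSpace ℝ (Fin 3)) 1)) (k : ℕ) (A G C P : Literature.Topology.FourManifolds.FramedSphereFamily (𝓡 4) N (Fin k) 2 2) (F T : Literature.Topology.FourManifolds.FramedSphereFamily (𝓡 4) N (Fin 1) 2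 2), Literature.Topology.FourManifolds.IsGeometricallyDual (𝓡 2) (𝓡 2) (𝓡 4) two_add_two_eq_four oS oS oN G.sphere A.sphere → Literature.Topology.FourManifolds.IsGeometricallyDual (𝓡 2) (𝓡 2) (𝓡 4) two_add_two_eq_four oS oS oN C.sphere P.sphere → (∀ i, (⟨A.sphere i, A.continuous_sphere i⟩ : C(↥(Metric.sphere (0 : EuclideanSpace ℝ (Fin 3)) 1), N)).Homotopic ⟨C.sphere i, C.continuous_sphere i⟩) → Literature.Topology.FourManifolds.IsGeometricallyDual (𝓡 2) (𝓡 2) (𝓡 4) two_add_two_eq_four oS oS oN F.sphere T.sphere → Disjoint (F.cores ∪ T.cores) (A.cores ∪ G.cores ∪ C.cores ∪ P.cores) → ∃ σ : Literature.Topology.FourManifolds.FramedSphereFamily (𝓡 4) N (Fin k) 2 2, Literature.Topology.FourManifolds.IsGeometricallyDual (𝓡 2) (𝓡 2) (𝓡 4) two_add_two_eq_four oS oS oN σ.sphere A.sphere ∧ Literature.Topology.FourManifolds.IsGeometricallyDual (𝓡 2) (𝓡 2) (𝓡 4) two_add_two_eq_four oS oS oN σ.sphere C.sphere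

-- earlier StabCancellation (stmt-SmoothPoincare4-15790, replaced 2026-08-16T16:27:01Z -> stmt-SmoothPoincare4-16193): retired by None — open scoped ContDiff in ∀ S : Literature.Topology.FourManifolds.HomotopySphere 4, (∃ (P : Type) (_ : TopologicalSpace P) (_ : ChartedSpace (EuclideanSpace ℝ (Fin 4)) P) (_ : IsManifold (𝓡 4) ∞ P), Literature.Topology.FourManifolds.IsConnectedSum (𝓡 4) (𝓡 4) ((𝓡 2).p
/-- item stmt-SmoothPoincare4-16193 · crux · rank 3 · open · by planner
why it might fail: = SPC4 on 1-stably standard Σ: a jointly knotted dual pair (A, G) ⊂ S²×S² with fake-ball complement refutes it; Gabai's LBT needs G standard; no 4-d one-summand cancellation theorem exists (false at b₂ > 0, arXiv:1009.0514 Cor. 16).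
sources: Gabai2020, WallJLMS1964, FreedmanGompfMorrisonWalker2010, arXiv:1009.0514, Matveyev1996, CurtisFreedmanHsiangStong1996
[crux] S2, ONE-SUMMAND CANCELLATION — rev 3 (cone repair): route Stabilisation's S2
(stmt-SmoothPoincare4-0385) stated over the bare binders of SmoothPoincare4 itself (M Hausdorff,
second countable, C^∞ atlas on 𝓡 4, e : M ≃ₕ S⁴; M is then compact and orientable by the PROVED tree
theorems compactSpace_of_homotopyEquiv_sphere_four_holds /
isOrientable_of_homotopyEquiv_sphere_four_holds, which provers may invoke — neither is a hypothesis,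
so the route imports no homotopy-sphere / h-cobordism module). EQUIVALENT to stmt-0385 (`∀ S :
HomotopySphere 4, …`): planner Bridge.lean (attached as evidence) proves bare ↔ packaged with
standard axioms, so a proof of either closes the other in four lines. Content: for every such M, if
some connected sum M # (S²×S²) (relational IsConnectedSum, sum modelled on 𝓡 4, S²×S² on (𝓡 2).prod
(𝓡 2)) is diffeomorphic to S²×S², then M is diffeomorphic to S⁴ — the LAST summand, which no
transfer touches (in dimension ≥ 5 it is automatic by the h-cobordism theorem). [difficulty:
open-problem] -/
@[route_item "route-SmoothPoincare4-CommonDualRelay"]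
def StabCancellation : Prop :=
  open scoped ContDiff in ∀ (M : Type) [TopologicalSpace M] [T2Space M] [SecondCountableTopology M] [ChartedSpace (EuclideanSpace ℝ (Fin 4)) M] [IsManifold (𝓡 4) ∞ M], ContinuousMap.HomotopyEquiv M (Metric.sphere (0 : EuclideanSpace ℝ (Fin 5)) 1) → (∃ (P : Type) (_ : TopologicalSpace P) (_ : ChartedSpace (EuclideanSpace ℝ (Fin 4)) P) (_ : IsManifold (𝓡 4) ∞ P), Literature.Topology.FourManifolds.IsConnectedSum (𝓡 4) (𝓡 4) ((𝓡 2).prod (𝓡 2)) M ((Metric.sphere (0 : EuclideanSpace ℝ (Fin 3)) 1) × (Metric.sphere (0 : EuclideanSpace ℝ (Fin 3)) 1)) P ∧ Nonempty (P ≃ₘ⟮𝓡 4, (𝓡 2).prod (𝓡 2)⟯ ((Metric.sphere (0 : EuclideanSpace ℝ (Fin 3)) 1) × (Metric.sphere (0 : EuclideanSpace ℝ (Fin 3)) 1)))) → Nonempty (M ≃ₘ⟮𝓡 4, 𝓡 4⟯ Metric.sphere (0 : EuclideanSpace ℝ (Fin 5)) 1)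

/-- item stmt-SmoothPoincare4-15791 · crux · rank 4 · open · by planner
why it might fail: true on paper; the risk is formal — it rests on the UNPROVED tree facts isHCobordant_sphere_of_homotopySphere_four and exists_dualSpheres_middleLevel_of_two_three plus an untyped Wall-1964 realisation theorem for Diff(#k S²×S²), whose Lean forms must match this ∃-form.
sources: KervaireMilnorAnnals1963, WallJLMS1964, WallDiffeomorphisms1964, MilnorHCobordism1965, Matveyev1996, KirbyCorks1996
[crux] FACT-GATE (the steps of Smale's proof that DO transfer, plus the classical normalisations the
relay needs): for every smooth homotopy 4-sphere M (the Statement's binders, e : M ≃ₕ S⁴) there are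
a closed simply connected smooth N, k, framed k-systems A, G, C, P and a free framed dual pair F, T
in N with G geometrically dual to A, C geometrically dual to P, Aᵢ ≃ Cᵢ, (F, T) disjoint from the
rest, such that surgery along A gives a connected sum M # (S²×S²) and surgery along C gives a copy
of S²×S². On paper: h-cobordism S⁴ ~ M (Θ₄ = 0), two-three handlebody, middle level N₀ ≅ #k(S²×S²)
with descending spheres A and belt spheres P (Milnor/Matveyev/Kirby), cores-with-discs C dual to P
and the symmetric Σ-side duals G of A (discs for trivial links in simply connected 4-manifolds),
Wall's realisation of the transvection aᵢ ↦ [Aᵢ] by a diffeomorphism of #k(S²×S²) to make Aᵢ ≃ Cᵢ,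
then N = N₀ # (S²×S²) with F, T the new factors. [difficulty: XL] -/
@[route_item "route-SmoothPoincare4-CommonDualRelay"]
def DualPresentation : Prop :=
  open scoped ContDiff in ∀ (M : Type) [TopologicalSpace M] [T2Space M] [SecondCountableTopology M] [ChartedSpace (EuclideanSpace ℝ (Fin 4)) M] [IsManifold (𝓡 4) ∞ M], M ≃ₕ (Metric.sphere (0 : EuclideanSpace ℝ (Fin 5)) 1) → ∃ (N : Type) (_ : TopologicalSpace N) (_ : T2Space N) (_ : SecondCountableTopology N) (_ : ChartedSpace (EuclideanSpace ℝ (Fin 4)) N) (_ : IsManifold (𝓡 4) ∞ N) (_ : CompactSpace N) (_ : SimplyConnectedSpace N) (oN : Literature.Topology.FourManifolds.SmoothOrientation (𝓡 4) N) (oS : Literature.Topology.FourManifolds.SmoothOrientation (𝓡 2) (Metric.sphere (0 : EuclideanSpace ℝ (Fin 3)) 1)) (k : ℕ) (A G C P : Literature.Topology.FourManifolds.FramedSphereFamily (𝓡 4) N (Fin k) 2 2) (F T : Literature.Topology.FourManifolds.FramedSphereFamily (𝓡 4) N (Fin 1) 2 2), Literature.Topology.FourManifolds.IsGeometricallyDual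 (𝓡 2) (𝓡 2) (𝓡 4) two_add_two_eq_four oS oS oN G.sphere A.sphere ∧ Literature.Topology.FourManifolds.IsGeometricallyDual (𝓡 2) (𝓡 2) (𝓡 4) two_add_two_eq_four oS oS oN C.sphere P.sphere ∧ (∀ i, (⟨A.sphere i, A.continuous_sphere i⟩ : C(↥(Metric.sphere (0 : EuclideanSpace ℝ (Fin 3)) 1), N)).Homotopic ⟨C.sphere i, C.continuous_sphere i⟩) ∧ Literature.Topology.FourManifolds.IsGeometricallyDual (𝓡 2) (𝓡 2) (𝓡 4) two_add_two_eq_four oS oS oN F.sphere T.sphere ∧ Disjoint (F.cores ∪ T.cores) (A.cores ∪ G.cores ∪ C.cores ∪ P.cores) ∧ (∃ (P₁ : Type) (_ : TopologicalSpace P₁) (_ : T2Space P₁) (_ : SecondCountableTopology P₁) (_ : ChartedSpace (EuclideanSpace ℝ (Fin 4)) P₁) (_ : IsManifold (𝓡 4) ∞ P₁), Literature.Topology.FourManifolds.IsConnectedSum (𝓡 4) (𝓡 4) ((𝓡 2).prod (𝓡 2)) M ((Metric.sphere (0 : EuclideanSpace ℝ (Fin 3)) 1) × (Metric.sphere (0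 : EuclideanSpace ℝ (Fin 3)) 1)) P₁ ∧ A.IsSurgery (𝓡 4) P₁) ∧ (∃ (Y : Type) (_ : TopologicalSpace Y) (_ : T2Space Y) (_ : SecondCountableTopology Y) (_ : ChartedSpace (EuclideanSpace ℝ (Fin 4)) Y) (_ : IsManifold (𝓡 4) ∞ Y), C.IsSurgery (𝓡 4) Y ∧ Nonempty (Y ≃ₘ⟮𝓡 4, ((𝓡 2).prod (𝓡 2))⟯ ((Metric.sphere (0 : EuclideanSpace ℝ (Fin 3)) 1) × (Metric.sphere (0 : EuclideanSpace ℝ (Fin 3)) 1))))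

/-- item stmt-SmoothPoincare4-18146 · crux · rank 5 · open · by planner
why it might fail: Leans on Wall 1964 Thm 2 = Kirby X.2 (UNPROVED tree fact exists_diffeomorph_freeCohomologyMap_eq_of_isometryEquiv, XL) for #(k−1)(S²×S²) # S²×S², plus Hurewicz π₂ = H₂; fails as typed if the sign conventions (oS,oP) vs (o,o) spoil the skewness of β, or if oN is not the orientation ψ preserves.
sources: WallDiffeomorphisms1964, WallJLMS1964, MilnorHCobordism1965, Gabai2020, FreedmanQuinn1990
[crux] WALL NORMALISATION, piece 3/4 of the split of DualPresentation (the homotopy clause Aᵢ ≃ Cᵢ):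
in a closed simply connected smooth 4-manifold N, let C be a framed k-system geometrically dual to a
framed k-system P with surgery along C giving S⁴, and A a framed (disjoint) k-system algebraically
dual to P. Then some geometrically dual framed pair (C′, P′) (same orientations o, oN), with surgery
along C′ still giving S⁴, has C′ᵢ homotopic to Aᵢ for every i. On paper: N ≅ #k(S²×S²) with
{[Cᵢ],[Pᵢ]} a hyperbolic basis (Pᵢ² = 0 forces the even framing); [Aᵢ] = [Cᵢ] + Σⱼ βᵢⱼ[Pⱼ] with β
skew and zero diagonal (Aᵢ·Pⱼ = δᵢⱼ, Aᵢ·Aⱼ = 0, Aᵢ² = 0), so T : [Cᵢ] ↦ [Aᵢ], [Pⱼ] ↦ [Pⱼ] is an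
isometry of H₂(N); Wall 1964 (Diffeomorphisms) Thm 2 realises T by an orientation-preserving
diffeomorphism ψ of N = #(k−1)(S²×S²) # S²×S² (k = 1: T = id); (C′, P′) = (ψC, ψP) stays
geometrically dual and framed, surgery along ψC gives S⁴ by transport
(FramedSphereFamily.IsSurgery.of_map_diffeomorph, proved), and [C′ᵢ] = [Aᵢ] gives Aᵢ ≃ C′ᵢ by
Hurewicz (π₁N = 1, free = based homotopy). Tree fact for Wall Thm 2:
exists_diffeomorph_freeCohomologyMap_eq_of_isometryEquiv (WallDiffeomorphisms.lean, UNPROVED). [d -/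
@[route_item "route-SmoothPoincare4-CommonDualRelay"]
def WallNormalisation : Prop :=
  open scoped ContDiff in ∀ (N : Type) [TopologicalSpace N] [T2Space N] [SecondCountableTopology N] [ChartedSpace (EuclideanSpace ℝ (Fin 4)) N] [IsManifold (𝓡 4) ∞ N] [CompactSpace N] [SimplyConnectedSpace N] (oN : Literature.Topology.FourManifolds.SmoothOrientation (𝓡 4) N) (oS oP o : Literature.Topology.FourManifolds.SmoothOrientation (𝓡 2) (Metric.sphere (0 : EuclideanSpace ℝ (Fin 3)) 1)) (k : ℕ) (A C P : Literature.Topology.FourManifolds.FramedSphereFamily (𝓡 4) N (Fin k) 2 2), Literature.Topology.FourManifolds.IsAlgebraicallyDual (𝓡 2) (𝓡 2) (𝓡 4) two_add_two_eq_four oS oP oN A.sphere P.sphere → Literature.Topology.FourManifolds.IsGeometricallyDual (𝓡 2) (𝓡 2) (𝓡 4) two_add_two_eq_four o o oN C.sphere P.sphere → C.IsSurgery (𝓡 4) (Metric.sphere (0 : EuclideanSpace ℝ (Fin 5)) 1) → ∃ (C' P' : Literature.Topology.FourManifolds.FramedSphereFamily (𝓡 4) N (Fin k) 2 2), Literature.Topology.FourManifolds.IsGeometricallyDual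 (𝓡 2) (𝓡 2) (𝓡 4) two_add_two_eq_four o o oN C'.sphere P'.sphere ∧ C'.IsSurgery (𝓡 4) (Metric.sphere (0 : EuclideanSpace ℝ (Fin 5)) 1) ∧ (∀ i, (⟨A.sphere i, A.continuous_sphere i⟩ : C(↥(Metric.sphere (0 : EuclideanSpace ℝ (Fin 3)) 1), N)).Homotopic ⟨C'.sphere i, C'.continuous_sphere i⟩)

/-- item stmt-SmoothPoincare4-18145 · crux · rank 6 · open · by planner
why it might fail: True only via a PARITY argument (Aᵢ·Pⱼ = δᵢⱼ, Aᵢ² = 0 = Pᵢ², H₂(M) = 0 ⇒ both surgery unlinks evenly framed; a section of S²×~S² has odd square and no framed dual); as typed it also needs homotopy ⇒ isotopy for circles in M and IsSurgery to pin the smooth structure near the cores.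
sources: KirbyCorks1996, Matveyev1996, GompfStipsicz1999, MilnorHCobordism1965, WallJLMS1964
[crux] GEOMETRIC DUAL UPGRADE, piece 2/4 of the split of DualPresentation: for a homotopy 4-sphere M
≃ₕ S⁴ presented from S⁴ by an algebraically dual pair of framed k-systems (A, P) in a closed simply
connected N (surgery along P gives S⁴, along A gives M), there are one orientation o of S² and
framed k-systems G, C in N with G GEOMETRICALLY dual to A and C geometrically dual to P (sign +1
with o on both sphere slots and the given oN), and surgery along C again gives S⁴. On paper:
reversing the two surgeries, N ≅ S⁴ ∪ (2-handles on a framed k-component link) and N ≅ M ∪ (…);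
links of circles in simply connected 4-manifolds are trivial (homotopy ⇒ isotopy, 2·1+2 = 4), so N ≅
S⁴ # k(S²-bundles) ≅ M # k(S²-bundles) with P resp. A the fibres; the PARITY argument Aᵢ·Pⱼ = δᵢⱼ,
Aᵢ² = 0 = Pᵢ², H₂(M) = 0 forces every bundle to be S²×S², and the sections (core disc ∪ null-isotopy
disc), corrected by copies of the fibre to square 0 and re-parametrised to sign +1, are the framed
duals C (S⁴ side, surgery along C gives S⁴) and G (M side). Sources: Kirby96 §1–2 (standard
pictures), Matveyev96 Def. 1, Gompf–Stipsicz §5.2, Milnor65 Def. 3.11. [difficulty: XL] -/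
@[route_item "route-SmoothPoincare4-CommonDualRelay"]
def DualUpgrade : Prop :=
  open scoped ContDiff in ∀ (M : Type) [TopologicalSpace M] [T2Space M] [SecondCountableTopology M] [ChartedSpace (EuclideanSpace ℝ (Fin 4)) M] [IsManifold (𝓡 4) ∞ M] (_ : M ≃ₕ Metric.sphere (0 : EuclideanSpace ℝ (Fin 5)) 1) (N : Type) [TopologicalSpace N] [T2Space N] [SecondCountableTopology N] [ChartedSpace (EuclideanSpace ℝ (Fin 4)) N] [IsManifold (𝓡 4) ∞ N] [CompactSpace N] [SimplyConnectedSpace N] (oN : Literature.Topology.FourManifolds.SmoothOrientation (𝓡 4) N) (oS oP : Literature.Topology.FourManifolds.SmoothOrientation (𝓡 2) (Metric.sphere (0 : EuclideanSpace ℝ (Fin 3)) 1)) (k : ℕ) (A P : Literature.Topology.FourManifolds.FramedSphereFamily (𝓡 4) N (Fin k) 2 2), Literature.Topology.FourManifolds.IsAlgebraicallyDual (𝓡 2) (𝓡 2) (𝓡 4) two_add_two_eq_four oS oP oN A.sphere P.sphere → P.IsSurgery (𝓡 4) (Metric.sphere (0 : EuclideanSpace ℝ (Fin 5)) 1) → A.IsSurgery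 (𝓡 4) M → ∃ (o : Literature.Topology.FourManifolds.SmoothOrientation (𝓡 2) (Metric.sphere (0 : EuclideanSpace ℝ (Fin 3)) 1)) (G C : Literature.Topology.FourManifolds.FramedSphereFamily (𝓡 4) N (Fin k) 2 2), Literature.Topology.FourManifolds.IsGeometricallyDual (𝓡 2) (𝓡 2) (𝓡 4) two_add_two_eq_four o o oN G.sphere A.sphere ∧ Literature.Topology.FourManifolds.IsGeometricallyDual (𝓡 2) (𝓡 2) (𝓡 4) two_add_two_eq_four o o oN C.sphere P.sphere ∧ C.IsSurgery (𝓡 4) (Metric.sphere (0 : EuclideanSpace ℝ (Fin 5)) 1)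

/-- item stmt-SmoothPoincare4-15792 · crux · rank 9 · open · by planner
why it might fail: Published (Gabai2020 Thm 10.1) but a FACT-GATE as typed: Gabai's 'Sᵢ coincides with Rᵢ near Gᵢ' clause is dropped (preliminary isotopy; needs sign +1 at both dual points, which IsGeometricallyDual gives) and only the end diffeo is kept; risk formal + XL tubed-surface machinery.
sources: Gabai2020, SchneidermanTeichner2022, arXiv:1705.09989
[support] NAMED FACT, Gabai's light bulb theorem for multiple spheres (Gabai2020 Thm 10.1, π₁ = 1
case, weakened to its end diffeomorphism): in a closed simply connected smooth 4-manifold, two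
framed k-systems A, C of pairwise disjoint embedded spheres with a common geometric dual system σ
and Aᵢ ≃ Cᵢ for all i are carried one onto the other by a self-diffeomorphism (the end of an ambient
isotopy fixing σ): φ(Aᵢ(S²)) = Cᵢ(S²). [difficulty: XL] -/
@[route_item "route-SmoothPoincare4-CommonDualRelay"]
def GabaiSystemsLightBulb : Prop :=
  open scoped ContDiff in ∀ (N : Type) [TopologicalSpace N] [T2Space N] [SecondCountableTopology N] [ChartedSpace (EuclideanSpace ℝ (Fin 4)) N] [IsManifold (𝓡 4) ∞ N] [CompactSpace N] [SimplyConnectedSpace N] (oN : Literature.Topology.FourManifolds.SmoothOrientation (𝓡 4) N) (oS : Literature.Topology.FourManifolds.SmoothOrientation (𝓡 2) (Metric.sphere (0 : EuclideanSpace ℝ (Fin 3)) 1)) (k : ℕ) (A C σ : Literature.Topology.FourManifolds.FramedSphereFamily (𝓡 4) N (Fin k) 2 2), Literature.Topology.FourManifolds.IsGeometricallyDual (𝓡 2) (𝓡 2) (𝓡 4) two_add_two_eq_four oS oS oN σ.sphere A.sphere → Literature.Topology.FourManifolds.IsGeometricallyDual (𝓡 2) (𝓡 2) (𝓡 4) two_add_two_eq_four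 oS oS oN σ.sphere C.sphere → (∀ i, (⟨A.sphere i, A.continuous_sphere i⟩ : C(↥(Metric.sphere (0 : EuclideanSpace ℝ (Fin 3)) 1), N)).Homotopic ⟨C.sphere i, C.continuous_sphere i⟩) → ∃ φ : N ≃ₘ⟮𝓡 4, 𝓡 4⟯ N, ∀ i, Set.range (φ ∘ A.sphere i) = Set.range (C.sphere i)

/-- item stmt-SmoothPoincare4-15793 · crux · rank 9 · open · by planner
why it might fail: Classical (surgery depends only on the framed image spheres: tubular-nbhd uniqueness, π₂(SO(2))=0, Diff(S²)≃O(3), uniqueness of open gluings), none in Mathlib; FALSE as typed if the relational IsSurgery/IsOpenGluing under-determines the glued smooth structure — check first.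
sources: MilnorHCobordism1965, GompfStipsicz1999, WallDiffeomorphisms1964
[support] bookkeeping (Milnor 1965 §3; Kosinski VI): if a self-diffeomorphism φ of a closed smooth
4-manifold N carries the core spheres of a framed family A onto those of a framed family C (as
images), then any surgery result along A is diffeomorphic to any surgery result along C (uniqueness
of tubular neighbourhoods; π₂(SO(2)) = 0 and reflections/reparametrisations extend over D³×S¹;
uniqueness of open gluings). [difficulty: XL] -/
@[route_item "route-SmoothPoincare4-CommonDualRelay"]
def SurgeryImageInvariance : Prop :=
  open scoped ContDiff in ∀ (N : Type) [TopologicalSpace N] [T2Space N] [SecondCountableTopology N] [ChartedSpace (EuclideanSpace ℝ (Fin 4)) N] [IsManifold (𝓡 4) ∞ N] [CompactSpace N] (φ : N ≃ₘ⟮𝓡 4, 𝓡 4⟯ N) (k : ℕ) (A C : Literature.Topology.FourManifolds.FramedSphereFamily (𝓡 4) N (Fin k) 2 2), (∀ i, Set.range (φ ∘ A.sphere i) = Set.range (C.sphere i)) → ∀ (X : Type) [TopologicalSpace X] [T2Space X] [SecondCountableTopology X] [ChartedSpace (EuclideanSpace ℝ (Fin 4)) X] [IsManifold (𝓡 4)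 ∞ X] (Y : Type) [TopologicalSpace Y] [T2Space Y] [SecondCountableTopology Y] [ChartedSpace (EuclideanSpace ℝ (Fin 4)) Y] [IsManifold (𝓡 4) ∞ Y], A.IsSurgery (𝓡 4) X → C.IsSurgery (𝓡 4) Y → Nonempty (X ≃ₘ⟮𝓡 4, 𝓡 4⟯ Y)

/-- item stmt-SmoothPoincare4-15794 · support · rank 9 · open · by planner
sources: AucklyEtAl2019, Gabai2020
[support] the k = 1 rung of R = the theorem of Auckly–Kim–Melvin–Ruberman–Schwartz (AucklyEtAl2019,
Theorem p. 3, ordinary case; the class of A is ordinary because its dual G is framed; complements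
are simply connected by Gabai2020 Lemma 2.2): one pair (A, C) with duals and one free summand ⇒ an
embedded framed common dual. Calibration of the vocabulary; provable from the printed 2-page
argument once finger/Whitney/Norman moves are formalised. [difficulty: L] -/
@[route_item "route-SmoothPoincare4-CommonDualRelay"]
def CommonDualOnePair : Prop :=
  open scoped ContDiff in ∀ (N : Type) [TopologicalSpace N] [T2Space N] [SecondCountableTopology N] [ChartedSpace (EuclideanSpace ℝ (Fin 4)) N] [IsManifold (𝓡 4) ∞ N] [CompactSpace N] [SimplyConnectedSpace N] (oN : Literature.Topology.FourManifolds.SmoothOrientation (𝓡 4) N) (oS : Literature.Topology.FourManifolds.SmoothOrientation (𝓡 2) (Metric.sphere (0 : EuclideanSpace ℝ (Fin 3)) 1)) (A G C P : Literature.Topology.FourManifolds.FramedSphereFamily (𝓡 4) N (Fin 1) 2 2) (F T : Literature.Topology.FourManifolds.FramedSphereFamily (𝓡 4) N (Fin 1) 2 2), Literature.Topology.FourManifolds.IsGeometricallyDual (𝓡 2) (𝓡 2) (𝓡 4) two_add_two_eq_four oS oS oN G.sphere A.sphere → Literature.Topology.FourManifolds.IsGeometricallyDual (𝓡 2) (𝓡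 2) (𝓡 4) two_add_two_eq_four oS oS oN C.sphere P.sphere → (∀ i, (⟨A.sphere i, A.continuous_sphere i⟩ : C(↥(Metric.sphere (0 : EuclideanSpace ℝ (Fin 3)) 1), N)).Homotopic ⟨C.sphere i, C.continuous_sphere i⟩) → Literature.Topology.FourManifolds.IsGeometricallyDual (𝓡 2) (𝓡 2) (𝓡 4) two_add_two_eq_four oS oS oN F.sphere T.sphere → Disjoint (F.cores ∪ T.cores) (A.cores ∪ G.cores ∪ C.cores ∪ P.cores) → ∃ σ : Literature.Topology.FourManifolds.FramedSphereFamily (𝓡 4) N (Fin 1) 2 2, Literature.Topology.FourManifolds.IsGeometricallyDual (𝓡 2) (𝓡 2) (𝓡 4) two_add_two_eq_four oS oS oN σ.sphere A.sphere ∧ Literature.Topology.FourManifolds.IsGeometricallyDual (𝓡 2) (𝓡 2) (𝓡 4) two_add_two_eq_four oS oS oN σ.sphere C.sphere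

/-- item stmt-SmoothPoincare4-15795 · support · rank 9 · open · by planner
sources: AucklyEtAl2019, Gabai2020, Kang2022OneStabilization
[support] the k = 2 rung of R (first open case; the smallest configuration where the summand budget
bites): two disjoint dual-equipped pairs, componentwise homotopic targets, one free summand ⇒ a
common dual system of two disjoint framed spheres. With Gabai Thm 10.1 it already yields "two
stabilisations ⇒ one" for homotopy 4-spheres presented with k = 2. [difficulty: open-problem] -/
@[route_item "route-SmoothPoincare4-CommonDualRelay"]
def TwoPairRelay : Prop :=
  open scoped ContDiff in ∀ (N : Type) [TopologicalSpace N] [T2Space N] [SecondCountableTopology N] [ChartedSpace (EuclideanSpace ℝ (Fin 4)) N] [IsManifold (𝓡 4) ∞ N] [CompactSpace N] [SimplyConnectedSpace N] (oN : Literature.Topology.FourManifolds.SmoothOrientation (𝓡 4) N) (oS : Literature.Topology.FourManifolds.SmoothOrientation (𝓡 2) (Metric.sphere (0 : EuclideanSpace ℝ (Fin 3)) 1)) (A G C P : Literature.Topology.FourManifolds.FramedSphereFamily (𝓡 4) N (Fin 2) 2 2) (F T : Literature.Topology.FourManifolds.FramedSphereFamily (𝓡 4) N (Fin 1) 2 2),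 Literature.Topology.FourManifolds.IsGeometricallyDual (𝓡 2) (𝓡 2) (𝓡 4) two_add_two_eq_four oS oS oN G.sphere A.sphere → Literature.Topology.FourManifolds.IsGeometricallyDual (𝓡 2) (𝓡 2) (𝓡 4) two_add_two_eq_four oS oS oN C.sphere P.sphere → (∀ i, (⟨A.sphere i, A.continuous_sphere i⟩ : C(↥(Metric.sphere (0 : EuclideanSpace ℝ (Fin 3)) 1), N)).Homotopic ⟨C.sphere i, C.continuous_sphere i⟩) → Literature.Topology.FourManifolds.IsGeometricallyDual (𝓡 2) (𝓡 2) (𝓡 4) two_add_two_eq_four oS oS oN F.sphere T.sphere → Disjoint (F.cores ∪ T.cores) (A.cores ∪ G.cores ∪ C.cores ∪ P.cores) → ∃ σ : Literature.Topology.FourManifolds.FramedSphereFamily (𝓡 4) N (Fin 2) 2 2, Literature.Topology.FourManifolds.IsGeometricallyDual (𝓡 2) (𝓡 2) (𝓡 4) two_add_two_eq_four oS oS oN σ.sphere A.sphere ∧ Literature.Topology.FourManifolds.IsGeometricallyDual (𝓡 2) (𝓡 2) (𝓡 4) two_add_two_eq_four oS oS oN σ.sphere C.sphere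

/-- item stmt-SmoothPoincare4-18144 · support · rank 9 · open · by planner
why it might fail: True on paper (KM63 p. 504; Milnor65 Thm 3.13 + Kirby96 §2); the risk is formal: it rests on the UNPROVED named facts isHCobordant_sphere_of_homotopySphere_four and exists_dualSpheres_middleLevel_of_two_three, whose ∃-forms (universe, cobordism direction, IsSurgery) must match.
sources: KervaireMilnorAnnals1963, MilnorHCobordism1965, KirbyCorks1996, Matveyev1996, WallJLMS1964
[support] FACT-GATE, piece 1/4 (filed SUPPORT here: the identical Prop is staffed as the rank-2 CRUX
stmt-SmoothPoincare4-11167 of route ThreePointSpheres, and this route is at the 7-crux cap; a proof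
there closes this item by `exact`) of the split of DualPresentation (= route ThreePointSpheres' crux
SpherePresentation, stmt-SmoothPoincare4-11167, the SAME Prop verbatim up to this route's `open
scoped ContDiff in` prefix — a proof of either closes the other by `exact`): every smooth homotopy
4-sphere M ≃ₕ S⁴ (the Statement's bare binders) has an ALGEBRAICALLY dual middle-level presentation
from S⁴ — a closed simply connected smooth N, orientations, k, framed k-systems S (descending
spheres) and P (belt spheres), IsAlgebraicallyDual S P, surgery along P gives S⁴, surgery along S
gives M. On paper: Θ₄ = 0 in h-cobordism form (named fact
isHCobordant_sphere_of_homotopySphere_four, UNPROVED) + two-three handle trading (PROVED,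
exists_isMorseFunction_two_three_of_isHCobordism_holds) + the middle-level fact (B)
exists_dualSpheres_middleLevel_of_two_three (UNPROVED) + packaging
(compactSpace_of_homotopyEquiv_sphere_four_holds, simple connectivity by transport). [difficulty:
XL] -/
@[route_item "route-SmoothPoincare4-CommonDualRelay"]
def SpherePresentation : Prop :=
  open scoped ContDiff in ∀ (M : Type) [TopologicalSpace M] [T2Space M] [SecondCountableTopology M] [ChartedSpace (EuclideanSpace ℝ (Fin 4)) M] [IsManifold (𝓡 4) ∞ M], M ≃ₕ Metric.sphere (0 : EuclideanSpace ℝ (Fin 5)) 1 → ∃ (N : Type) (_ : TopologicalSpace N) (_ : T2Space N) (_ : SecondCountableTopology N) (_ : ChartedSpace (EuclideanSpace ℝ (Fin 4)) N) (_ : IsManifold (𝓡 4) ∞ N) (_ : CompactSpace N) (_ : SimplyConnectedSpace N) (oN : Literature.Topology.FourManifolds.SmoothOrientation (𝓡 4) N) (oS oP : Literature.Topology.FourManifolds.SmoothOrientation (𝓡 2) (Metric.sphere (0 : EuclideanSpace ℝ (Fin 3)) 1)) (k : ℕ) (S P : Literature.Topology.FourManifolds.FramedSphereFamily (𝓡 4)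 N (Fin k) 2 2), Literature.Topology.FourManifolds.IsAlgebraicallyDual (𝓡 2) (𝓡 2) (𝓡 4) two_add_two_eq_four oS oP oN S.sphere P.sphere ∧ P.IsSurgery (𝓡 4) (Metric.sphere (0 : EuclideanSpace ℝ (Fin 5)) 1) ∧ S.IsSurgery (𝓡 4) M

/-- item stmt-SmoothPoincare4-18147 · support · rank 9 · open · by planner
why it might fail: Bookkeeping on paper, XL formally: needs 'surgery commutes with a connected sum taken off the tubes' for the relational IsSurgery/IsConnectedSum, transport of IsGeometricallyDual (orienting N # S²×S² over oN) and of the homotopies Aᵢ ≃ Cᵢ (tracks pushed off the summing ball), and S⁴ # S²×S² ≅ S²×S².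
sources: WallJLMS1964, KervaireMilnorAnnals1963, GompfStipsicz1999, MilnorHCobordism1965
[support] ONE STABILISATION (bookkeeping rung; load-bearing premise 4/4 of DualPresentationGlue;
filed support so the route keeps ≤ 7 load-bearing cruxes — the risk is purely formal), piece 4/4 of
the split of DualPresentation (bookkeeping rung): given, in a closed simply connected N, framed
k-systems A, G, C, P with G geometrically dual to A, C geometrically dual to P (orientations o, oN),
Aᵢ ≃ Cᵢ, surgery along A giving M and surgery along C giving S⁴, produce the full conclusion of
DualPresentation for M: N′ (on paper N # (S²×S²), the sum taken at a point off all tubes), the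
transported systems A′ G′ C′ P′, the free framed dual pair (F, T) = the two factor spheres of the
new summand, disjoint from the rest, surgery along A′ giving a connected sum M # (S²×S²) (surgery
commutes with a connected sum performed away from the spheres) and surgery along C′ giving S⁴ #
(S²×S²) ≅ S²×S². Classical (Kervaire–Milnor §2, Wall 1964 JLMS §1, Gompf–Stipsicz §5.2); the formal
debt is the commutation of the relational IsSurgery with IsConnectedSum, transport of geometric
duality and of the homotopies along the summand embedding, and X # S⁴ ≅ X (proved in tree,
SeamAdaptedWitnesses). M carries onl -/
@[route_item "route-SmoothPoincare4-CommonDualRelay"]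
def StabiliseOnce : Prop :=
  open scoped ContDiff in ∀ (M : Type) [TopologicalSpace M] [T2Space M] [SecondCountableTopology M] [ChartedSpace (EuclideanSpace ℝ (Fin 4)) M] [IsManifold (𝓡 4) ∞ M] (N : Type) [TopologicalSpace N] [T2Space N] [SecondCountableTopology N] [ChartedSpace (EuclideanSpace ℝ (Fin 4)) N] [IsManifold (𝓡 4) ∞ N] [CompactSpace N] [SimplyConnectedSpace N] (oN : Literature.Topology.FourManifolds.SmoothOrientation (𝓡 4) N) (o : Literature.Topology.FourManifolds.SmoothOrientation (𝓡 2) (Metric.sphere (0 : EuclideanSpace ℝ (Fin 3)) 1)) (k : ℕ) (A G C P : Literature.Topology.FourManifolds.FramedSphereFamily (𝓡 4) N (Fin k) 2 2), Literature.Topology.FourManifolds.IsGeometricallyDual (𝓡 2) (𝓡 2) (𝓡 4) two_add_two_eq_four o o oN G.sphere A.sphere → Literature.Topology.FourManifolds.IsGeometricallyDual (𝓡 2) (𝓡 2) (𝓡 4) two_add_two_eq_four o o oN C.sphere P.sphere → (∀ i, (⟨A.sphere i, A.continuous_sphere i⟩ : C(↥(Metric.sphere (0 : EuclideanSpace ℝ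 (Fin 3)) 1), N)).Homotopic ⟨C.sphere i, C.continuous_sphere i⟩) → A.IsSurgery (𝓡 4) M → C.IsSurgery (𝓡 4) (Metric.sphere (0 : EuclideanSpace ℝ (Fin 5)) 1) → ∃ (N' : Type) (_ : TopologicalSpace N') (_ : T2Space N') (_ : SecondCountableTopology N') (_ : ChartedSpace (EuclideanSpace ℝ (Fin 4)) N') (_ : IsManifold (𝓡 4) ∞ N') (_ : CompactSpace N') (_ : SimplyConnectedSpace N') (oN' : Literature.Topology.FourManifolds.SmoothOrientation (𝓡 4) N') (oS : Literature.Topology.FourManifolds.SmoothOrientation (𝓡 2) (Metric.sphere (0 : EuclideanSpace ℝ (Fin 3)) 1)) (k' : ℕ) (A' G' C' P' : Literature.Topology.FourManifolds.FramedSphereFamily (𝓡 4) N' (Fin k') 2 2) (F T : Literature.Topology.FourManifolds.FramedSphereFamily (𝓡 4) N' (Fin 1) 2 2), Literature.Topology.FourManifolds.IsGeometricallyDual (𝓡 2) (𝓡 2) (𝓡 4) two_add_two_eq_four oS oS oN' G'.sphere A'.sphere ∧ Literature.Topology.FourManifolds.IsGeometricallyDual (𝓡 2) (𝓡 2) (𝓡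 4) two_add_two_eq_four oS oS oN' C'.sphere P'.sphere ∧ (∀ i, (⟨A'.sphere i, A'.continuous_sphere i⟩ : C(↥(Metric.sphere (0 : EuclideanSpace ℝ (Fin 3)) 1), N')).Homotopic ⟨C'.sphere i, C'.continuous_sphere i⟩) ∧ Literature.Topology.FourManifolds.IsGeometricallyDual (𝓡 2) (𝓡 2) (𝓡 4) two_add_two_eq_four oS oS oN' F.sphere T.sphere ∧ Disjoint (F.cores ∪ T.cores) (A'.cores ∪ G'.cores ∪ C'.cores ∪ P'.cores) ∧ (∃ (P₁ : Type) (_ : TopologicalSpace P₁) (_ : T2Space P₁) (_ : SecondCountableTopology P₁) (_ : ChartedSpace (EuclideanSpace ℝ (Fin 4)) P₁) (_ : IsManifold (𝓡 4) ∞ P₁), Literature.Topology.FourManifolds.IsConnectedSum (𝓡 4) (𝓡 4) ((𝓡 2).prod (𝓡 2)) M ((Metric.sphere (0 : EuclideanSpace ℝ (Fin 3)) 1) × (Metric.sphere (0 : EuclideanSpace ℝ (Fin 3)) 1)) P₁ ∧ A'.IsSurgery (𝓡 4) P₁) ∧ (∃ (Y : Type) (_ : TopologicalSpace Y) (_ :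 T2Space Y) (_ : SecondCountableTopology Y) (_ : ChartedSpace (EuclideanSpace ℝ (Fin 4)) Y) (_ : IsManifold (𝓡 4) ∞ Y), C'.IsSurgery (𝓡 4) Y ∧ Nonempty (Y ≃ₘ⟮𝓡 4, ((𝓡 2).prod (𝓡 2))⟯ ((Metric.sphere (0 : EuclideanSpace ℝ (Fin 3)) 1) × (Metric.sphere (0 : EuclideanSpace ℝ (Fin 3)) 1))))

/-- item stmt-SmoothPoincare4-18148 · support · rank 9 · open · by planner
[support] [glue] the typed decomposition of the fact-gate crux DualPresentation
(stmt-SmoothPoincare4-15791) along its own on-paper stages — present M from S⁴ by an algebraically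
dual middle-level pair (SpherePresentation = ThreePointSpheres' stmt-11167 verbatim), upgrade both
sides to framed GEOMETRIC duals with C surgering to S⁴ (DualUpgrade), realise the transvection [Cᵢ]
↦ [Aᵢ] by Wall's diffeomorphism so that Aᵢ ≃ C′ᵢ (WallNormalisation), stabilise once for the free
pair (F, T) and the two surgery clauses (StabiliseOnce). PROVED by the planner (Sketch.lean
`dualPresentation_of_subs`: intro M … e; obtain from h₁; obtain from h₂; obtain from h₃; exact h₄ —
5 tactic lines, lean check rc 0, 0 sorries, standard axioms), landed as
Theorems/CommonDualRelayDualPresentationGlue.lean; with it DualPresentation is DERIVED from the four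
pieces (BC2 redirect: per-piece probes Xi → SmoothPoincare4 and Xi → DualPresentation fail 8/8).
Filed as items + glue because `route edit --split` is refused to non-final-cycle seats; a later
`--split DualPresentation --glue-by` can re-hang the same four decls as children. [difficulty:
provable-now] -/
@[route_item "route-SmoothPoincare4-CommonDualRelay"]
def DualPresentationGlue : Prop :=
  SpherePresentation → DualUpgrade → WallNormalisation → StabiliseOnce → DualPresentation

/-- item stmt-SmoothPoincare4-15796 · assembly · rank 1 · open · by planner
sources: WallJLMS1964, Gabai2020, AucklyEtAl2019
[assembly] DualPresentation → OneSummandCommonDuals → GabaiSystemsLightBulb → SurgeryImageInvariance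
→ StabCancellation → SmoothPoincare4. -/
@[route_item "route-SmoothPoincare4-CommonDualRelay"]
def Assembly : Prop :=
  DualPresentation → OneSummandCommonDuals → GabaiSystemsLightBulb → SurgeryImageInvariance → StabCancellation → SmoothPoincare4

/-! D-0027 §2.1 — DECIDING THEOREM (planner-authored via `route open/edit --closes-file`; by planner-rrepair-SmoothPoincare4-CommonDualRela-0210b6e0-0 2026-08-16T16:27:01Z):
its hypotheses are this route's items and its conclusion the sub-problem Statement (glue_lint), and it elaborates with this file. -/

@[closes "route-SmoothPoincare4-CommonDualRelay"] theorem closes (hP : DualPresentation) (hR : OneSummandCommonDuals) (hG : GabaiSystemsLightBulb)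
    (hI : SurgeryImageInvariance) (h₂ : StabCancellation) : _root_.SmoothPoincare4 := by
  intro M _ _ _ _ _ e
  refine h₂ M e ?_
  obtain ⟨N, _, _, _, _, _, _, _, oN, oS, k, A, G, C, P, F, T, hGA, hCP, hAC, hFT, hdisj,
    ⟨P₁, _, _, _, _, _, hsum, hA⟩, ⟨Y, _, _, _, _, _, hC, ⟨ψ⟩⟩⟩ := hP M e
  obtain ⟨σ, hσA, hσC⟩ := hR N oN oS k A G C P F T hGA hCP hAC hFT hdisj
  obtain ⟨φ, hφ⟩ := hG N oN oS k A C σ hσA hσC hAC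
  obtain ⟨χ⟩ := hI N φ k A C hφ P₁ Y hA hC
  exact ⟨P₁, inferInstance, inferInstance, inferInstance, hsum, ⟨χ.trans ψ⟩⟩

end Summit.SmoothPoincare4.SmoothPoincare4.Theses.CommonDualRelay
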